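import Summits.Langlands.Langlands.Theorems.PicardMuOrdinaryMuOrdinaryFamilyRTThorneArithmeticPoints
import Literature.NumberTheory.GaloisRepresentations.GaloisRepUnramifiedProofs
import Literature.NumberTheory.GaloisRepresentations.AbsIntegersEquiv
import HarnessLib

/-!
# Crux `MuOrdinaryFamilyRT` (stmt-Langlands-13757), line `thorne-minimal-lift`:
# leaf `pointRep_isUnramifiedAt` — the point representations are unramified outside `S₀`, also after
# restriction to any number field `L ⊇ K`, and at the places of `L` above `S₀` whose inertia is killed (PROVED)

Leaf P4 of wave 4 (glue for `stub_pointAutomorphic`): hypotheses (iii) ("`ρ` almost everywhere unramified")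
and the unramified half of (iv)(b) ("`ρ|Γ_{F_v}` unramified at every `v ∤ p`") of the named fact
`Thorne2017.automorphyLifting_unitary_ordinaryMinimal`, for the point representation `ρ_y = y ∘ 𝓕.ρ`
(`pointRep 𝓕 y`, framed as `ρy` with `∀ g, ρy g = pointRep 𝓕 y g`) of a family `𝓕 : OrdFamily f ι e S₀ ρ_C` and
its restrictions `ρy.restrictField L` to number fields `L ⊇ K`.

* § 1 bookkeeping for an arbitrary framed representation `ρ : Γ_k → GL_n(A)` of a number field `k` (no family
  involved; applies verbatim to the companions `r^c` of `HasOrdinaryCompanion` and to twists):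
  - `isUnramifiedAt_restrictField_of_under_eq` — unramified at `v` ⇒ `ρ|Γ_L` unramified at every `w ∣ v`
    (`res_k^L(I_𝔔) ≤ I_{ι⁻¹𝔔}`, tree `absGaloisRestrict_mem_inertia_comap`; `ι⁻¹𝔔 ∣ v`, tree
    `comap_absIntegersMap_mem_primesAbove`);
  - `isUnramifiedAt_restrictField_restrictField_iff` — along a tower `k ⊆ F' ⊆ L`, `(ρ|Γ_{F'})|Γ_L` and `ρ|Γ_L`
    differ by a fixed inner automorphism (`exists_absGaloisRestrict_comp_eq_conj`), so they are unramified at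
    the same places;
  - `isUnramifiedAt_iff_forall_absInertia` — the LOCAL CRITERION "unramified at `w` iff `res_L^{L_w}(I_{L_w})`
    acts trivially" for framed representations (the tree's discharged local–global compatibility
    `GaloisRep.isUnramifiedAt_iff_toLocal_holds`, Neukirch II (9.6));
  - `exists_decompositionTransport_of_algebra` — for ANY `k`-compatible algebra structure `k_v → L_w` the
    restriction `φ = res_{k_v}^{L_w}` transports the decomposition group, `res_k^L ∘ res_L^{L_w} = γ·(res_k^{k_v} ∘ φ)·γ⁻¹`,
    and `φ(I_{L_w}) ⊆ I_{k_v}` (`absInertia_map_absGaloisRestrict_le_holds`);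
  - KILLING INERTIA: `isUnramifiedAt_restrictField_of_transport` (if `ρ ∘ res_k^{k_v} ∘ φ` kills `I_{L_w}` along
    such a transport then `ρ|Γ_L` is unramified at `w`), its instance form `…_of_algebra`, and the
    `PotUnramified` form `isUnramifiedAt_restrictField_of_openSubgroup` (an open `U ≤ Γ_{k_v}` with
    `ρ(res τ) = 1` on `I_{k_v} ∩ U`, and `res_{k_v}^{L_w}(I_{L_w}) ⊆ U`);
  - `finite_setOf_under_mem` — only finitely many places of `L` lie above a finite set of places of `k`;
    `natCast_mem_under_iff` — `w ∣ m` iff `w.under (𝓞 k) ∣ m` for `m ∈ ℕ`.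
* § 2 `pointRep_isUnramifiedAt` — (1): `𝓕.unramified v : Deformation.IsUnramifiedAt v 𝓕.ρ` (`v ∉ S₀`) pushes
  through `y` (`Deformation.IsUnramifiedAt` and `FramedGaloisRep.IsUnramifiedAt` are the same global notion);
  `pointRep_isUnramifiedAt_eventually` — (2): hence `∀ᶠ v in cofinite`.
* § 3 `pointRep_restrictField_isUnramifiedAt` — (3): `ρy|Γ_L` is unramified at every place `w` of `L` with
  `w.under (𝓞 K) ∉ S₀`; `pointRep_restrictField_isUnramifiedAt_eventually` — hence `∀ᶠ w in cofinite`.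
* § 4 (4), the `PotUnramifiedFamily` clause: with `U ≤ Γ_{K_v}` open and `𝓕.ρ(res_K^{K_v} τ) = 1` for
  `τ ∈ I_{K_v} ∩ U`, `ρy|Γ_L` is unramified at every place `w` of `L` whose decomposition group transports into
  `Γ_{K_v}` with `φ(I_{L_w}) ⊆ I_{K_v} ∩ U` (`pointRep_restrictField_isUnramifiedAt_of_transport`, the abstract
  transport form `(γ, φ)` of `arithmeticPoints_decompositionTransport`), resp. for which some `K`-compatible
  `K_v → L_w` has `res_{K_v}^{L_w}(I_{L_w}) ⊆ U` (`pointRep_restrictField_isUnramifiedAt_of_algebra` — the shape a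
  soluble `L/K` with prescribed local extensions, CHT 2008 Lemma 4.1.2, delivers); and the assembled
  (iv)(b)-shape `pointRep_restrictField_isUnramifiedAt_away`: unramified at EVERY `w ∤ 3` of `L`, given such
  transports at the places above `S₀ ∖ {3}`.

No named fact, no definition.
-/

set_option linter.dupNamespace false -- `Summit.Langlands.Langlands.…` is the problem's namespace

namespace Summit.Langlands.Langlands.Cruxes.MuOrdinaryFamilyRT.ThorneMinimalLift

open scoped NumberField Polynomial Matrix Classical
open Field IsDedekindDomain Polynomial Filter
open Literature.NumberTheory.GaloisRepresentations Literature.NumberTheory.Automorphic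
open Summit.Langlands.Langlands.Cruxes.MuOrdinaryFamilyRT.CharZeroDominance

noncomputable section

variable {f : ℤ[X]} {ι : PadicAlgCl 3 ≃+* ℂ} {e : K →+* ℂ} {S₀ : Finset (HeightOneSpectrum (𝓞 K))}
  {ρC : FramedGaloisRep K (PadicAlgCl 3) 3}

/-! ## 1. Bookkeeping for framed representations of number fields -/

section General

variable {k : Type*} [Field k] {A : Type*} [CommRing A] [TopologicalSpace A] {n : ℕ}

/-- **Restriction to `Γ_L` preserves unramifiedness.**  If `ρ : Γ_k → GL_n(A)` is unramified at `v` then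
`ρ|Γ_L = ρ ∘ res_k^L` is unramified at every place `w` of `L` above `v`: for a prime `𝔔 ∣ w` of `\bar ℤ_L`,
`res_k^L(I_𝔔) ≤ I_{ι⁻¹ 𝔔}` and `ι⁻¹ 𝔔 ∣ v`. -/
theorem isUnramifiedAt_restrictField_of_under_eq (L : Type*) [Field L] [Algebra k L]
    (ρ : FramedGaloisRep k A n) {v : HeightOneSpectrum (𝓞 k)} {w : HeightOneSpectrum (𝓞 L)}
    (hw : w.asIdeal.under (𝓞 k) = v.asIdeal) (h : ρ.IsUnramifiedAt v) :
    (ρ.restrictField L).IsUnramifiedAt w := by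
  intro 𝔔 h𝔔 σ hσ
  rw [FramedGaloisRep.restrictField_apply]
  exact h _ (comap_absIntegersMap_mem_primesAbove hw h𝔔) _ (absGaloisRestrict_mem_inertia_comap k L hσ)

/-- **Towers.**  Along `k ⊆ F' ⊆ L` the two restrictions `(ρ|Γ_{F'})|Γ_L` and `ρ|Γ_L` differ by the fixed inner
automorphism `ρ(γ)` relating `res_k^{F'} ∘ res_{F'}^L` and `res_k^L` (`exists_absGaloisRestrict_comp_eq_conj`), so
one is unramified at `w` iff the other is. -/
theorem isUnramifiedAt_restrictField_restrictField_iff (F' L : Type*) [Field F'] [Field L] [Algebra k F']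
    [Algebra k L] [Algebra F' L] [IsScalarTower k F' L] (ρ : FramedGaloisRep k A n) (w : HeightOneSpectrum (𝓞 L)) :
    ((ρ.restrictField F').restrictField L).IsUnramifiedAt w ↔ (ρ.restrictField L).IsUnramifiedAt w := by
  obtain ⟨γ, hγ⟩ := exists_absGaloisRestrict_comp_eq_conj k F' L
  refine forall₂_congr fun 𝔔 _ => forall₂_congr fun σ _ => ?_
  rw [FramedGaloisRep.restrictField_apply, FramedGaloisRep.restrictField_apply,
    FramedGaloisRep.restrictField_apply, hγ, map_mul, map_mul, map_inv, mul_inv_eq_one, mul_eq_left]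

/-- **Local criterion for unramifiedness of a framed representation.**  For a number field `L` and a
finite place `w`, `ρ : Γ_L → GL_n(A)` is unramified at `w` (every `I_𝔔`, `𝔔 ∣ w`, maps to `1`) iff it kills
the inertia group `I_{L_w}` of the local field `L_w` pushed forward by the chosen restriction
`res_L^{L_w} : Γ_{L_w} → Γ_L` (the tree's discharged local–global compatibility
`GaloisRep.isUnramifiedAt_iff_toLocal_holds`, Neukirch II (9.6), moved to framed representations). -/
theorem isUnramifiedAt_iff_forall_absInertia [IsTopologicalRing A] {L : Type*} [Field L] [NumberField L]
    (ρ : FramedGaloisRep L A n) (w : HeightOneSpectrum (𝓞 L)) :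
    ρ.IsUnramifiedAt w ↔
      ∀ σ ∈ absInertia (w.adicCompletion L), ρ (absGaloisRestrict L (w.adicCompletion L) σ) = 1 := by
  rw [← FramedGaloisRep.isUnramifiedAt_toGaloisRep_iff, GaloisRep.isUnramifiedAt_iff_toLocal_holds w ρ.toGaloisRep]
  refine forall₂_congr fun σ _ => ?_
  rw [GaloisRep.toLocal_apply]
  change FramedRep.toRepresentation ρ (absGaloisRestrict L (w.adicCompletion L) σ) = 1 ↔ _
  constructor
  · intro h
    have h1 : Matrix.toLin' ((ρ (absGaloisRestrict L (w.adicCompletion L) σ) : GL (Fin n) A) :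
        Matrix (Fin n) (Fin n) A) = Matrix.toLin' 1 := by
      rw [Matrix.toLin'_one]
      refine LinearMap.ext fun x => ?_
      simpa using congr($h x)
    exact Units.ext (Matrix.toLin'.injective h1)
  · intro h
    refine LinearMap.ext fun x => ?_
    simp [h]

/-- **The decomposition group of `w` transports into `Γ_{k_v}` along any `k`-compatible algebra structure
`k_v → L_w`.**  For number fields `L ⊇ k`, places `v` of `k` and `w` of `L`, and ANY algebra structure
`k_v → L_w` compatible with `k → L → L_w` (e.g. the continuous extension `adicCompletionMap` of `k → L` when
`w ∣ v`), the restriction `φ = res_{k_v}^{L_w} : Γ_{L_w} → Γ_{k_v}` satisfies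
`res_k^L ∘ res_L^{L_w} = γ · (res_k^{k_v} ∘ φ) · γ⁻¹` for a fixed `γ ∈ Γ_k` (tower conjugacy of the chosen restriction
maps, twice) and `φ(I_{L_w}) ⊆ I_{k_v}` (`absInertia_map_absGaloisRestrict_le_holds`, valid for any algebra
structure between local fields). -/
-- adapted from `arithmeticPoints_decompositionTransport` (…ThorneArithmeticPoints), without its restriction `w ∣ 3`
theorem exists_decompositionTransport_of_algebra [NumberField k] (L : Type*) [Field L] [NumberField L]
    [Algebra k L] (v : HeightOneSpectrum (𝓞 k)) (w : HeightOneSpectrum (𝓞 L))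
    [Algebra (v.adicCompletion k) (w.adicCompletion L)] [IsScalarTower k (v.adicCompletion k) (w.adicCompletion L)] :
    ∃ γ : absoluteGaloisGroup k,
      (∀ τ : absoluteGaloisGroup (w.adicCompletion L),
        absGaloisRestrict k L (absGaloisRestrict L (w.adicCompletion L) τ) =
          γ * absGaloisRestrict k (v.adicCompletion k)
            (absGaloisRestrict (v.adicCompletion k) (w.adicCompletion L) τ) * γ⁻¹) ∧
      ∀ τ ∈ absInertia (w.adicCompletion L),
        absGaloisRestrict (v.adicCompletion k) (w.adicCompletion L) τ ∈ absInertia (v.adicCompletion k) := by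
  obtain ⟨γ₁, hγ₁⟩ := exists_absGaloisRestrict_comp_eq_conj k L (w.adicCompletion L)
  obtain ⟨γ₂, hγ₂⟩ := exists_absGaloisRestrict_comp_eq_conj k (v.adicCompletion k) (w.adicCompletion L)
  refine ⟨γ₁ * γ₂⁻¹, fun τ => ?_, fun τ hτ => ?_⟩
  · rw [hγ₁, show absGaloisRestrict k (w.adicCompletion L) τ =
        γ₂⁻¹ * absGaloisRestrict k (v.adicCompletion k)
          (absGaloisRestrict (v.adicCompletion k) (w.adicCompletion L) τ) * γ₂ by rw [hγ₂]; group]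
    group
  · exact absInertia_map_absGaloisRestrict_le_holds (v.adicCompletion k) (w.adicCompletion L)
      (Subgroup.mem_map_of_mem _ hτ)

/-- **Killing inertia along a transport.**  Let `w` be a place of the number field `L ⊇ k` whose decomposition
group transports into `Γ_{k_v}`: `res_k^L(res_L^{L_w} τ) = γ · res_k^{k_v}(φ τ) · γ⁻¹` for all `τ ∈ Γ_{L_w}`, for some
`γ ∈ Γ_k` and `φ : Γ_{L_w} → Γ_{k_v}`.  If `ρ ∘ res_k^{k_v} ∘ φ` kills the inertia group `I_{L_w}`, then `ρ|Γ_L` is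
unramified at `w` (local criterion; `ρ|Γ_L(res_L^{L_w} τ) = ρ(γ) · 1 · ρ(γ)⁻¹`). -/
theorem isUnramifiedAt_restrictField_of_transport [IsTopologicalRing A] [NumberField k] {L : Type*} [Field L] [NumberField L]
    [Algebra k L] (ρ : FramedGaloisRep k A n) {v : HeightOneSpectrum (𝓞 k)} {w : HeightOneSpectrum (𝓞 L)}
    {γ : absoluteGaloisGroup k} {φ : absoluteGaloisGroup (w.adicCompletion L) → absoluteGaloisGroup (v.adicCompletion k)}
    (hγ : ∀ τ : absoluteGaloisGroup (w.adicCompletion L),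
      absGaloisRestrict k L (absGaloisRestrict L (w.adicCompletion L) τ) =
        γ * absGaloisRestrict k (v.adicCompletion k) (φ τ) * γ⁻¹)
    (h : ∀ τ ∈ absInertia (w.adicCompletion L), ρ (absGaloisRestrict k (v.adicCompletion k) (φ τ)) = 1) :
    (ρ.restrictField L).IsUnramifiedAt w := by
  rw [isUnramifiedAt_iff_forall_absInertia]
  intro τ hτ
  rw [FramedGaloisRep.restrictField_apply, hγ, map_mul, map_mul, map_inv, h τ hτ, mul_one, mul_inv_cancel]

/-- **Killing inertia, instance form.**  For ANY `k`-compatible algebra structure `k_v → L_w`: if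
`ρ ∘ res_k^{k_v} ∘ res_{k_v}^{L_w}` kills `I_{L_w}`, then `ρ|Γ_L` is unramified at `w`. -/
theorem isUnramifiedAt_restrictField_of_algebra [IsTopologicalRing A] [NumberField k] {L : Type*} [Field L]
    [NumberField L] [Algebra k L] (ρ : FramedGaloisRep k A n) (v : HeightOneSpectrum (𝓞 k))
    (w : HeightOneSpectrum (𝓞 L)) [Algebra (v.adicCompletion k) (w.adicCompletion L)]
    [IsScalarTower k (v.adicCompletion k) (w.adicCompletion L)]
    (h : ∀ τ ∈ absInertia (w.adicCompletion L),
      ρ (absGaloisRestrict k (v.adicCompletion k) (absGaloisRestrict (v.adicCompletion k) (w.adicCompletion L) τ)) = 1) :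
    (ρ.restrictField L).IsUnramifiedAt w := by
  obtain ⟨γ, hγ, -⟩ := exists_decompositionTransport_of_algebra (k := k) L v w
  exact isUnramifiedAt_restrictField_of_transport ρ hγ h

/-- **Killing inertia, `PotUnramified` form.**  If an open subgroup `U ≤ Γ_{k_v}` of inertia acts trivially through
`ρ ∘ res_k^{k_v}` (the clauses `PotUnramifiedAway`, `PotUnramifiedFamily`, `HasOrdinaryCompanion` (c)) and some
`k`-compatible algebra structure `k_v → L_w` has `res_{k_v}^{L_w}(I_{L_w}) ⊆ U` ("`L_w` contains the extension of `k_v`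
cut out by `U`"), then `ρ|Γ_L` is unramified at `w` (`res_{k_v}^{L_w}(I_{L_w}) ⊆ I_{k_v}` automatically). -/
theorem isUnramifiedAt_restrictField_of_openSubgroup [IsTopologicalRing A] [NumberField k] {L : Type*} [Field L]
    [NumberField L] [Algebra k L] (ρ : FramedGaloisRep k A n) (v : HeightOneSpectrum (𝓞 k))
    (U : OpenSubgroup (absoluteGaloisGroup (v.adicCompletion k)))
    (hU : ∀ τ ∈ absInertia (v.adicCompletion k), τ ∈ U → ρ (absGaloisRestrict k (v.adicCompletion k) τ) = 1)
    (w : HeightOneSpectrum (𝓞 L)) [Algebra (v.adicCompletion k) (w.adicCompletion L)]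
    [IsScalarTower k (v.adicCompletion k) (w.adicCompletion L)]
    (hIU : ∀ τ ∈ absInertia (w.adicCompletion L), absGaloisRestrict (v.adicCompletion k) (w.adicCompletion L) τ ∈ U) :
    (ρ.restrictField L).IsUnramifiedAt w := by
  obtain ⟨γ, hγ, hI⟩ := exists_decompositionTransport_of_algebra (k := k) L v w
  exact isUnramifiedAt_restrictField_of_transport ρ hγ fun τ hτ => hU _ (hI τ hτ) (hIU τ hτ)

/-- A rational integer `m` lies in the place `w` of `L` iff it lies in the place `w.under (𝓞 k)` of `k` below it
(so "`w ∤ 3`" over `L` is "`v ∤ 3`" for `v = w.under (𝓞 K)`, the guard of `PotUnramifiedFamily`). -/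
theorem natCast_mem_under_iff {L : Type*} [Field L] [NumberField L] [Algebra k L] (w : HeightOneSpectrum (𝓞 L))
    (m : ℕ) : ((m : ℕ) : 𝓞 k) ∈ (w.under (𝓞 k)).asIdeal ↔ ((m : ℕ) : 𝓞 L) ∈ w.asIdeal := by
  rw [HeightOneSpectrum.under_asIdeal, Ideal.under_def, Ideal.mem_comap, map_natCast]

/-- Only finitely many places of a number field `L ⊇ k` lie above a given finite set of places of `k`
(Mathlib `IsDedekindDomain.primesOver_finite`, place by place). -/
theorem finite_setOf_under_mem [NumberField k] {L : Type*} [Field L] [NumberField L] [Algebra k L]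
    (S : Finset (HeightOneSpectrum (𝓞 k))) :
    {w : HeightOneSpectrum (𝓞 L) | w.under (𝓞 k) ∈ S}.Finite := by
  have key : ∀ v : HeightOneSpectrum (𝓞 k), {w : HeightOneSpectrum (𝓞 L) | w.under (𝓞 k) = v}.Finite := by
    intro v
    haveI : v.asIdeal.IsMaximal := v.isMaximal
    have hfin := IsDedekindDomain.primesOver_finite v.asIdeal (𝓞 L)
    refine (hfin.preimage (f := fun w : HeightOneSpectrum (𝓞 L) => w.asIdeal)
      fun _ _ _ _ h => HeightOneSpectrum.ext h).subset ?_
    intro w hw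
    have hw' : (w.under (𝓞 k)).asIdeal = v.asIdeal := congrArg HeightOneSpectrum.asIdeal hw
    exact ⟨w.isPrime, ⟨hw'.symm⟩⟩
  refine ((S.finite_toSet).biUnion fun v _ => key v).subset ?_
  intro w hw
  exact Set.mem_biUnion hw rfl

end General

/-! ## 2. The point representation is unramified outside `S₀` -/

/-- `ρ_y = y ∘ 𝓕.ρ` is unramified wherever the family is: `Deformation.IsUnramifiedAt v 𝓕.ρ` pushes through `y`. -/
theorem isUnramifiedAt_of_forall_eq_pointRep (𝓕 : OrdFamily f ι e S₀ ρC) (y : 𝓕.R →+* PadicAlgCl 3)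
    {ρy : FramedGaloisRep K (PadicAlgCl 3) 3} (hρy : ∀ g, ρy g = pointRep 𝓕 y g)
    {v : HeightOneSpectrum (𝓞 K)} (hv : Deformation.IsUnramifiedAt v 𝓕.ρ) : ρy.IsUnramifiedAt v := by
  intro 𝔓 h𝔓 σ hσ
  rw [hρy]
  change Matrix.GeneralLinearGroup.map y (𝓕.ρ σ) = 1
  rw [hv 𝔓 h𝔓 σ hσ, map_one]

/-- **(1) Hypothesis (iii) at finite level, registered leaf `pointRep_isUnramifiedAt`.**  For every family
`𝓕 : OrdFamily f ι e S₀ ρ_C`, every `ℚ̄₃`-point `y` and every framed `ρy` agreeing with `pointRep 𝓕 y`, `ρy` is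
unramified at every `v ∉ S₀` (`𝓕.unramified`: the family itself is unramified outside `S₀`). -/
theorem pointRep_isUnramifiedAt : ∀ (f : ℤ[X]) (ι : PadicAlgCl 3 ≃+* ℂ) (e : K →+* ℂ) (S₀ : Finset (HeightOneSpectrum (𝓞 K))) (ρC : FramedGaloisRep K (PadicAlgCl 3) 3) (𝓕 : OrdFamily f ι e S₀ ρC) (y : 𝓕.R →+* PadicAlgCl 3) (ρy : FramedGaloisRep K (PadicAlgCl 3) 3), (∀ g, ρy g = pointRep 𝓕 y g) → ∀ v : HeightOneSpectrum (𝓞 K), v ∉ S₀ → ρy.IsUnramifiedAt v := by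
  intro f ι e S₀ ρC 𝓕 y ρy hρy v hv
  exact isUnramifiedAt_of_forall_eq_pointRep 𝓕 y hρy (𝓕.unramified v hv)

/-- **(2) Hypothesis (iii), registered leaf `pointRep_isUnramifiedAt_eventually`.**  `ρy` is unramified at all
but finitely many places of `K` (`S₀` is finite). -/
theorem pointRep_isUnramifiedAt_eventually : ∀ (f : ℤ[X]) (ι : PadicAlgCl 3 ≃+* ℂ) (e : K →+* ℂ) (S₀ : Finset (HeightOneSpectrum (𝓞 K))) (ρC : FramedGaloisRep K (PadicAlgCl 3) 3) (𝓕 : OrdFamily f ι e S₀ ρC) (y : 𝓕.R →+* PadicAlgCl 3) (ρy : FramedGaloisRep K (PadicAlgCl 3) 3), (∀ g, ρy g = pointRep 𝓕 y g) → ∀ᶠ v : HeightOneSpectrum (𝓞 K) in cofinite, ρy.IsUnramifiedAt v := by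
  intro f ι e S₀ ρC 𝓕 y ρy hρy
  rw [Filter.eventually_cofinite]
  refine S₀.finite_toSet.subset fun v hv => ?_
  by_contra h
  exact hv (pointRep_isUnramifiedAt f ι e S₀ ρC 𝓕 y ρy hρy v h)

/-! ## 3. Restrictions to number fields `L ⊇ K` are unramified outside the places above `S₀` -/

/-- **(3) Registered leaf `pointRep_restrictField_isUnramifiedAt`.**  For a number field `L ⊇ K`, `ρy|Γ_L`
is unramified at every place `w` of `L` whose restriction `w.under (𝓞 K)` to `K` is not in `S₀`. -/
theorem pointRep_restrictField_isUnramifiedAt : ∀ (f : ℤ[X]) (ι : PadicAlgCl 3 ≃+* ℂ) (e : K →+* ℂ) (S₀ : Finset (HeightOneSpectrum (𝓞 K))) (ρC : FramedGaloisRep K (PadicAlgCl 3) 3) (𝓕 : OrdFamily f ι e S₀ ρC) (y : 𝓕.R →+* PadicAlgCl 3) (ρy : FramedGaloisRep K (PadicAlgCl 3) 3), (∀ g, ρy g = pointRep 𝓕 y g) → ∀ (L : Type) [Field L] [NumberField L] [Algebra K L] (w : HeightOneSpectrum (𝓞 L)), w.under (𝓞 K) ∉ S₀ → (ρy.restrictField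 L).IsUnramifiedAt w := by
  intro f ι e S₀ ρC 𝓕 y ρy hρy L _ _ _ w hw
  exact isUnramifiedAt_restrictField_of_under_eq L ρy (v := w.under (𝓞 K)) rfl
    (pointRep_isUnramifiedAt f ι e S₀ ρC 𝓕 y ρy hρy _ hw)

/-- **(3') Hypothesis (iii) over `L`, registered leaf `pointRep_restrictField_isUnramifiedAt_eventually`.**
`ρy|Γ_L` is unramified at all but finitely many places of `L` (the places above `S₀` are finitely many). -/
theorem pointRep_restrictField_isUnramifiedAt_eventually : ∀ (f : ℤ[X]) (ι : PadicAlgCl 3 ≃+* ℂ) (e : K →+* ℂ) (S₀ : Finset (HeightOneSpectrum (𝓞 K))) (ρC : FramedGaloisRep K (PadicAlgCl 3) 3) (𝓕 : OrdFamily f ι e S₀ ρC) (y : 𝓕.R →+* PadicAlgCl 3) (ρy : FramedGaloisRep K (PadicAlgCl 3) 3), (∀ g, ρy g = pointRep 𝓕 y g) → ∀ (L : Type) [Field L] [NumberField L] [Algebra K L], ∀ᶠ w : HeightOneSpectrum (𝓞 L) in cofinite, (ρy.restrictField L).IsUnramifiedAt w := by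
  intro f ι e S₀ ρC 𝓕 y ρy hρy L _ _ _
  rw [Filter.eventually_cofinite]
  refine (finite_setOf_under_mem (k := K) (L := L) S₀).subset fun w hw => ?_
  by_contra h
  exact hw (pointRep_restrictField_isUnramifiedAt f ι e S₀ ρC 𝓕 y ρy hρy L w h)

/-! ## 4. Killing inertia at the places above `S₀` (the `PotUnramifiedFamily` clause) -/

/-- **(4) Registered leaf `pointRep_restrictField_isUnramifiedAt_of_transport`.**  Let `U ≤ Γ_{K_v}` be an open
subgroup with `𝓕.ρ(res_K^{K_v} τ) = 1` for all `τ ∈ I_{K_v} ∩ U` (the clause of `PotUnramifiedFamily 𝓕` at `v`).  Let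
`L ⊇ K` be a number field and `w` a place of `L` whose decomposition group transports into `Γ_{K_v}` inside `U`:
`res_K^L(res_L^{L_w} τ) = γ · res_K^{K_v}(φ τ) · γ⁻¹` for all `τ`, with `φ(I_{L_w}) ⊆ I_{K_v}` and `φ(I_{L_w}) ⊆ U` (the
transport form of `arithmeticPoints_decompositionTransport`).  Then `ρy|Γ_L` is unramified at `w`. -/
theorem pointRep_restrictField_isUnramifiedAt_of_transport : ∀ (f : ℤ[X]) (ι : PadicAlgCl 3 ≃+* ℂ) (e : K →+* ℂ) (S₀ : Finset (HeightOneSpectrum (𝓞 K))) (ρC : FramedGaloisRep K (PadicAlgCl 3) 3) (𝓕 : OrdFamily f ι e S₀ ρC) (v : HeightOneSpectrum (𝓞 K)) (U : OpenSubgroup (absoluteGaloisGroup (v.adicCompletion K))), (∀ τ ∈ absInertia (v.adicCompletion K), τ ∈ U → 𝓕.ρ (absGaloisRestrict K (v.adicCompletion K) τ) = 1) → ∀ (y : 𝓕.R →+* PadicAlgCl 3) (ρy : FramedGaloisRep K (PadicAlgCl 3) 3), (∀ g, ρy g = pointRep 𝓕 y g) → ∀ (L : Type) [Field L] [NumberField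 L] [Algebra K L] (w : HeightOneSpectrum (𝓞 L)) (γ : absoluteGaloisGroup K) (φ : absoluteGaloisGroup (w.adicCompletion L) → absoluteGaloisGroup (v.adicCompletion K)), (∀ τ : absoluteGaloisGroup (w.adicCompletion L), absGaloisRestrict K L (absGaloisRestrict L (w.adicCompletion L) τ) = γ * absGaloisRestrict K (v.adicCompletion K) (φ τ) * γ⁻¹) → (∀ τ ∈ absInertia (w.adicCompletion L), φ τ ∈ absInertia (v.adicCompletion K)) → (∀ τ ∈ absInertia (w.adicCompletion L), φ τ ∈ U) → (ρy.restrictField L).IsUnramifiedAt w := by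
  intro f ι e S₀ ρC 𝓕 v U hU y ρy hρy L _ _ _ w γ φ hγ hI hIU
  refine isUnramifiedAt_restrictField_of_transport ρy hγ fun τ hτ => ?_
  rw [hρy]
  change Matrix.GeneralLinearGroup.map y (𝓕.ρ (absGaloisRestrict K (v.adicCompletion K) (φ τ))) = 1
  rw [hU _ (hI τ hτ) (hIU τ hτ), map_one]

/-- **(4') Registered leaf `pointRep_restrictField_isUnramifiedAt_of_algebra` (killing inertia, instance form).**
With `U ≤ Γ_{K_v}` as in `PotUnramifiedFamily 𝓕` at `v`: for a number field `L ⊇ K`, a place `w` of `L` and ANY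
`K`-compatible algebra structure `K_v → L_w` (e.g. `adicCompletionMap` when `w ∣ v`) whose restriction map
`res_{K_v}^{L_w} : Γ_{L_w} → Γ_{K_v}` sends `I_{L_w}` into `U`, `ρy|Γ_L` is unramified at `w`. -/
theorem pointRep_restrictField_isUnramifiedAt_of_algebra : ∀ (f : ℤ[X]) (ι : PadicAlgCl 3 ≃+* ℂ) (e : K →+* ℂ) (S₀ : Finset (HeightOneSpectrum (𝓞 K))) (ρC : FramedGaloisRep K (PadicAlgCl 3) 3) (𝓕 : OrdFamily f ι e S₀ ρC) (v : HeightOneSpectrum (𝓞 K)) (U : OpenSubgroup (absoluteGaloisGroup (v.adicCompletion K))), (∀ τ ∈ absInertia (v.adicCompletion K), τ ∈ U → 𝓕.ρ (absGaloisRestrict K (v.adicCompletion K) τ) = 1) → ∀ (y : 𝓕.R →+* PadicAlgCl 3) (ρy : FramedGaloisRep K (PadicAlgCl 3) 3), (∀ g, ρy g = pointRep 𝓕 y g) → ∀ (L : Type) [Field L] [NumberField L] [Algebra K L] (w : HeightOneSpectrum (𝓞 L)) [Algebra (v.adicCompletion K) (w.adicCompletion L)] [IsScalarTower K (v.adicCompletion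 K) (w.adicCompletion L)], (∀ τ ∈ absInertia (w.adicCompletion L), absGaloisRestrict (v.adicCompletion K) (w.adicCompletion L) τ ∈ U) → (ρy.restrictField L).IsUnramifiedAt w := by
  intro f ι e S₀ ρC 𝓕 v U hU y ρy hρy L _ _ _ w _ _ hIU
  obtain ⟨γ, hγ, hI⟩ := exists_decompositionTransport_of_algebra (k := K) L v w
  exact pointRep_restrictField_isUnramifiedAt_of_transport f ι e S₀ ρC 𝓕 v U hU y ρy hρy L w γ _ hγ hI hIU

/-- **(4'') The assembled (iv)(b)-shape, registered leaf `pointRep_restrictField_isUnramifiedAt_away`.**  If at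
every place `w ∤ 3` of `L` above `S₀` an open subgroup of `I_{K_v}`, `v = w.under (𝓞 K)`, acting trivially through
`𝓕.ρ` receives `I_{L_w}` along a transport of the decomposition group of `w` (as delivered place by place by
`PotUnramifiedFamily 𝓕` and a soluble `L/K` with large local degrees), then `ρy|Γ_L` is unramified at EVERY place
`w ∤ 3` of `L` — the conjunct `ρ.IsUnramifiedAt v` of hypothesis (iv)(b) of Thorne's theorem for `ρ = ρy|Γ_L`. -/
theorem pointRep_restrictField_isUnramifiedAt_away : ∀ (f : ℤ[X]) (ι : PadicAlgCl 3 ≃+* ℂ) (e : K →+* ℂ) (S₀ : Finset (HeightOneSpectrum (𝓞 K))) (ρC : FramedGaloisRep K (PadicAlgCl 3) 3) (𝓕 : OrdFamily f ι e S₀ ρC) (y : 𝓕.R →+* PadicAlgCl 3) (ρy : FramedGaloisRep K (PadicAlgCl 3) 3), (∀ g, ρy g = pointRep 𝓕 y g) → ∀ (L : Type) [Field L] [NumberField L] [Algebra K L], (∀ w : HeightOneSpectrum (𝓞 L), w.under (𝓞 K) ∈ S₀ → ((3 : ℕ) : 𝓞 L) ∉ w.asIdeal → ∃ (U : OpenSubgroup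 (absoluteGaloisGroup ((w.under (𝓞 K)).adicCompletion K))) (γ : absoluteGaloisGroup K) (φ : absoluteGaloisGroup (w.adicCompletion L) → absoluteGaloisGroup ((w.under (𝓞 K)).adicCompletion K)), (∀ τ ∈ absInertia ((w.under (𝓞 K)).adicCompletion K), τ ∈ U → 𝓕.ρ (absGaloisRestrict K ((w.under (𝓞 K)).adicCompletion K) τ) = 1) ∧ (∀ τ : absoluteGaloisGroup (w.adicCompletion L), absGaloisRestrict K L (absGaloisRestrict L (w.adicCompletion L) τ) = γ * absGaloisRestrict K ((w.under (𝓞 K)).adicCompletion K) (φ τ) * γ⁻¹) ∧ (∀ τ ∈ absInertia (w.adicCompletion L), φ τ ∈ absInertia ((w.under (𝓞 K)).adicCompletion K)) ∧ (∀ τ ∈ absInertia (w.adicCompletion L), φ τ ∈ U)) → ∀ w : HeightOneSpectrum (𝓞 L), ((3 : ℕ) : 𝓞 L) ∉ w.asIdeal → (ρy.restrictField L).IsUnramifiedAt w := by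
  intro f ι e S₀ ρC 𝓕 y ρy hρy L _ _ _ hS w hw3
  by_cases hw : w.under (𝓞 K) ∈ S₀
  · obtain ⟨U, γ, φ, hU, hγ, hI, hIU⟩ := hS w hw hw3
    exact pointRep_restrictField_isUnramifiedAt_of_transport f ι e S₀ ρC 𝓕 _ U hU y ρy hρy L w γ φ hγ hI hIU
  · exact pointRep_restrictField_isUnramifiedAt f ι e S₀ ρC 𝓕 y ρy hρy L w hw

end

end Summit.Langlands.Langlands.Cruxes.MuOrdinaryFamilyRT.ThorneMinimalLift
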